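import Mathlib.Data.ZMod.Basic
import Mathlib.Data.Nat.Sqrt
import Mathlib.Data.Fintype.Pigeonhole
import Mathlib.Data.Nat.Prime.Basic
import Mathlib.Tactic.Linarith
import Mathlib.Tactic.LinearCombination
import Mathlib.Tactic.Ring
import Mathlib.Algebra.Order.Ring.Abs
import Mathlib.Algebra.Group.Even
import HarnessLib

/-!
# Route `RamifiedHeegnerPair`, crux U₁ `LeafRankOneUpperAtThree` (stmt-BirchSwinnertonDyer-26022), line `partnerdescent` —
# input (C4), last arithmetic brick: a prime modulo which `x² + x + 1` has a root is a NORM from `ℤ[ζ₃]` (Thue's lemma)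

HONEST FRAMING. Theorems only; helper file (`--supports stmt-BirchSwinnertonDyer-26022 --as helper`); elementary number theory over Mathlib
(pigeonhole ∕ Thue), no named fact, no `sorry`; nothing booked; BSD is proved for no curve. Lead prover bsd-line-rhp-p2 g61, 2026-08-31
(memo `Cruxes/LeafRankOneUpperAtThree/LEAD-G61-G3-CORE.md` §7).

WHY. The fixed-point exclusion behind (DIV) `w_k ∣ T(ℓ)_{ik}` (‹…LeafPartnerBrandtWeightDvd›: a unit `u ≠ ±1` of `O_L(I_k)` fixing a sub-ideal
`J ⊂ I_k` of index `ℓ²` forces `J = πI_k`) needs a NORM-`ℓ` ELEMENT `π = a + bu` of `ℤ[u]`, where `u` has order `4` (`ℤ[u] = ℤ[i]`, norm form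
`a² + b²` — Mathlib `Nat.Prime.sq_add_sq`) or order `3 ∕ 6` (`ℤ[u] = ℤ[ζ₃]`, norm form `a² + ab + b²`, NOT in Mathlib), as soon as the minimal
polynomial of `u` has a root modulo `ℓ`. This file supplies the missing case by Thue's lemma: if `ℓ ∣ x² + x + 1` for some integer `x`, then
`ℓ = a² + ab + b²` (`exists_sq_add_mul_add_sq_eq_of_dvd`). Proof: pigeonhole on `(u, v) ↦ u − xv (mod ℓ)` over `0 ≤ u, v ≤ ⌊√ℓ⌋` gives
`(a, b) ≠ 0` with `a ≡ xb`, `|a|, |b| ≤ ⌊√ℓ⌋`; then `ℓ ∣ a² + ab + b² = b²(x² + x + 1) + ℓ(…)`, `0 < a² + ab + b² < 3ℓ`, and the value `2ℓ` is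
excluded by parity (`a² + ab + b²` is even only when `a, b` are both even, and `x² + x + 1` is odd).
[cite: HardyWright2008, §20.4 Thm. 366–367 (Thue's lemma and two squares; the same argument for `a² + ab + b²`, Thm. 254 on primes `6m + 1`)]
-/

set_option linter.dupNamespace false
set_option autoImplicit false

namespace Summit.BirchSwinnertonDyer.BirchSwinnertonDyer.Theorems.LeafPartnerBrandt

/-- **Thue's lemma** (pigeonhole form): for a prime `p` and any integer `x` there are integers `a, b`, not both zero, with `|a| ≤ ⌊√p⌋`,
`|b| ≤ ⌊√p⌋` and `p ∣ a − xb`. [cite: HardyWright2008, §20.4 Thm. 366] -/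
theorem exists_small_congr (p : ℕ) (hp : p.Prime) (x : ℤ) :
    ∃ a b : ℤ, (a ≠ 0 ∨ b ≠ 0) ∧ |a| ≤ Nat.sqrt p ∧ |b| ≤ Nat.sqrt p ∧ (p : ℤ) ∣ a - x * b := by
  haveI : NeZero p := ⟨hp.ne_zero⟩
  set m := Nat.sqrt p with hm
  have hcard : Fintype.card (ZMod p) < Fintype.card (Fin (m + 1) × Fin (m + 1)) := by
    rw [ZMod.card, Fintype.card_prod, Fintype.card_fin, ← pow_two]
    exact Nat.lt_succ_sqrt' p
  obtain ⟨⟨u₁, v₁⟩, ⟨u₂, v₂⟩, hne, heq⟩ := Fintype.exists_ne_map_eq_of_card_lt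
    (fun uv : Fin (m + 1) × Fin (m + 1) => (((uv.1 : ℕ) : ℤ) - x * ((uv.2 : ℕ) : ℤ) : ZMod p)) hcard
  refine ⟨((u₁ : ℕ) : ℤ) - ((u₂ : ℕ) : ℤ), ((v₁ : ℕ) : ℤ) - ((v₂ : ℕ) : ℤ), ?_, ?_, ?_, ?_⟩
  · by_contra h
    push Not at h
    obtain ⟨h₁, h₂⟩ := h
    apply hne
    have hu : (u₁ : ℕ) = u₂ := by exact_mod_cast sub_eq_zero.mp h₁
    have hv : (v₁ : ℕ) = v₂ := by exact_mod_cast sub_eq_zero.mp h₂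
    rw [Prod.mk.injEq]
    exact ⟨Fin.ext hu, Fin.ext hv⟩
  · have h1 : ((u₁ : ℕ) : ℤ) ≤ m := by exact_mod_cast Nat.lt_succ_iff.mp u₁.2
    have h2 : ((u₂ : ℕ) : ℤ) ≤ m := by exact_mod_cast Nat.lt_succ_iff.mp u₂.2
    rw [abs_le]; constructor <;> linarith [Int.natCast_nonneg (u₁ : ℕ), Int.natCast_nonneg (u₂ : ℕ)]
  · have h1 : ((v₁ : ℕ) : ℤ) ≤ m := by exact_mod_cast Nat.lt_succ_iff.mp v₁.2
    have h2 : ((v₂ : ℕ) : ℤ) ≤ m := by exact_mod_cast Nat.lt_succ_iff.mp v₂.2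
    rw [abs_le]; constructor <;> linarith [Int.natCast_nonneg (v₁ : ℕ), Int.natCast_nonneg (v₂ : ℕ)]
  · rw [← ZMod.intCast_zmod_eq_zero_iff_dvd]
    have heq' : (((u₁ : ℕ) : ℤ) - x * ((v₁ : ℕ) : ℤ) : ZMod p) = (((u₂ : ℕ) : ℤ) - x * ((v₂ : ℕ) : ℤ) : ZMod p) := heq
    push_cast at heq' ⊢
    linear_combination heq'

/-- `a² + ab + b²` is even only if `a` and `b` are both even. [folklore] -/
theorem even_and_even_of_even_norm {a b : ℤ} (h : Even (a ^ 2 + a * b + b ^ 2)) : Even a ∧ Even b := by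
  rcases Int.even_or_odd a with ⟨k, hk⟩ | ⟨k, hk⟩ <;> rcases Int.even_or_odd b with ⟨l, hl⟩ | ⟨l, hl⟩
  · exact ⟨⟨k, hk⟩, ⟨l, hl⟩⟩
  · exfalso
    rw [hk, hl] at h
    obtain ⟨r, hr⟩ := h
    have : (2 : ℤ) ∣ 1 := ⟨r - (2 * k * k + 2 * k * l + k + 2 * l * l + 2 * l), by linarith⟩
    omega
  · exfalso
    rw [hk, hl] at h
    obtain ⟨r, hr⟩ := h
    have : (2 : ℤ) ∣ 1 := ⟨r - (2 * k * k + 2 * k + 2 * k * l + l + 2 * l * l), by linarith⟩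
    omega
  · exfalso
    rw [hk, hl] at h
    obtain ⟨r, hr⟩ := h
    have : (2 : ℤ) ∣ 1 := ⟨r - (2 * k * k + 2 * k + 2 * k * l + k + l + 2 * l * l + 2 * l + 1), by linarith⟩
    omega

/-- **A prime modulo which `x² + x + 1` has a root is of the form `a² + ab + b²`** (a norm from `ℤ[ζ₃]`): if `p` is prime and `p ∣ x² + x + 1`
for some integer `x`, then `p = a² + ab + b²` for some integers `a, b`. (Thue's lemma; the companion of Mathlib's `Nat.Prime.sq_add_sq` for the
norm form of `ℤ[i]`.) In the (DIV) fixed-point exclusion this supplies the norm-`ℓ` element `π = a + bζ₃` of `ℤ[ζ₃] ⊂ O_L(I_k)` when the unit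
`u` has order `3` or `6`. [cite: HardyWright2008, §20.4 Thm. 366–367, §15 Thm. 254] -/
theorem exists_sq_add_mul_add_sq_eq_of_dvd {p : ℕ} (hp : p.Prime) {x : ℤ} (hx : (p : ℤ) ∣ x ^ 2 + x + 1) :
    ∃ a b : ℤ, a ^ 2 + a * b + b ^ 2 = p := by
  obtain ⟨a, b, hab0, ha, hb, hab⟩ := exists_small_congr p hp x
  set m := Nat.sqrt p with hm
  have hp0 : (0 : ℤ) < p := by exact_mod_cast hp.pos
  -- `m² < p` (a prime is not a square)
  have hm2 : (m : ℤ) ^ 2 < p := by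
    have hle : m ^ 2 ≤ p := Nat.sqrt_le' p
    rcases hle.lt_or_eq with hlt | heq
    · exact_mod_cast hlt
    · exfalso
      have hm1 : m ∣ p := ⟨m, by rw [← heq, pow_two]⟩
      rcases (Nat.dvd_prime hp).mp hm1 with h1 | h1
      · rw [h1, one_pow] at heq; exact hp.one_lt.ne' heq.symm
      · rw [h1, pow_two] at heq
        have : p * p = p * 1 := by rw [mul_one]; exact heq
        have := Nat.eq_of_mul_eq_mul_left hp.pos this
        exact hp.one_lt.ne' this
  -- `p ∣ N := a² + ab + b²`
  have hN : (p : ℤ) ∣ a ^ 2 + a * b + b ^ 2 := by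
    obtain ⟨k, hk⟩ := hab
    obtain ⟨c, hc⟩ := hx
    have haeq : a = x * b + p * k := by linarith
    refine ⟨b ^ 2 * c + k * (2 * x * b + p * k + b), ?_⟩
    rw [haeq]
    have : (x * b + ↑p * k) ^ 2 + (x * b + ↑p * k) * b + b ^ 2 = b ^ 2 * (x ^ 2 + x + 1) + p * (k * (2 * x * b + p * k + b)) := by ring
    rw [this, hc]
    ring
  -- `0 < N < 3p`
  have hpos : 0 < a ^ 2 + a * b + b ^ 2 := by
    rcases hab0 with h0 | h0
    · have : 0 < a ^ 2 := by positivity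
      nlinarith [sq_nonneg (a + 2 * b), sq_nonneg (2 * a + b)]
    · have : 0 < b ^ 2 := by positivity
      nlinarith [sq_nonneg (a + 2 * b), sq_nonneg (2 * a + b)]
  have hlt : a ^ 2 + a * b + b ^ 2 < 3 * p := by
    have ha2 : a ^ 2 ≤ (m : ℤ) ^ 2 := by
      rw [← sq_abs]; exact pow_le_pow_left₀ (abs_nonneg a) ha 2
    have hb2 : b ^ 2 ≤ (m : ℤ) ^ 2 := by
      rw [← sq_abs]; exact pow_le_pow_left₀ (abs_nonneg b) hb 2
    have hab2 : a * b ≤ (m : ℤ) ^ 2 := by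
      calc a * b ≤ |a * b| := le_abs_self _
        _ = |a| * |b| := abs_mul a b
        _ ≤ m * m := mul_le_mul ha hb (abs_nonneg b) (by positivity)
        _ = (m : ℤ) ^ 2 := (pow_two _).symm
    linarith
  -- `N = p` or `N = 2p`; the latter is excluded by parity
  obtain ⟨c, hc⟩ := hN
  have hc1 : c = 1 ∨ c = 2 := by
    have h1 : 0 < c := by
      by_contra h
      push Not at h
      have : (p : ℤ) * c ≤ 0 := mul_nonpos_of_nonneg_of_nonpos hp0.le h
      linarith
    have h2 : c < 3 := by
      by_contra h
      push Not at h
      have : (3 : ℤ) * p ≤ p * c := by nlinarith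
      linarith
    omega
  rcases hc1 with rfl | rfl
  · exact ⟨a, b, by rw [hc, mul_one]⟩
  · exfalso
    -- `a, b` even ⟹ `4 ∣ 2p` ⟹ `p = 2`; but `x² + x + 1` is odd
    have heven : Even (a ^ 2 + a * b + b ^ 2) := ⟨p, by rw [hc]; ring⟩
    obtain ⟨⟨k, hk⟩, ⟨l, hl⟩⟩ := even_and_even_of_even_norm heven
    have h4 : (4 : ℤ) ∣ (p : ℤ) * 2 := by
      rw [← hc, hk, hl]
      exact ⟨k * k + k * l + l * l, by ring⟩
    have h2p : (2 : ℤ) ∣ (p : ℤ) := by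
      obtain ⟨r, hr⟩ := h4
      exact ⟨r, by linarith⟩
    have hp2 : p = 2 := by
      have : 2 ∣ p := by exact_mod_cast h2p
      exact ((Nat.dvd_prime hp).mp this).resolve_left (by norm_num) |>.symm
    subst hp2
    -- `2 ∣ x² + x + 1` is impossible
    obtain ⟨c, hc'⟩ := hx
    rcases Int.even_or_odd x with ⟨y, hy⟩ | ⟨y, hy⟩
    · have : (2 : ℤ) ∣ 1 := ⟨c - (2 * y * y + y), by rw [hy] at hc'; push_cast at hc'; linarith⟩
      omega
    · have : (2 : ℤ) ∣ 1 := ⟨c - (2 * y * y + 3 * y + 1), by rw [hy] at hc'; push_cast at hc'; linarith⟩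
      omega

end Summit.BirchSwinnertonDyer.BirchSwinnertonDyer.Theorems.LeafPartnerBrandt
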